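import Mathlib
import Summits.ValiantsHypothesis.ValiantsHypothesis.Theorems.LiouvilleSarnakAlignedCutRank
import Literature.Computability.AlgebraicComplexity.BooleanGadgets
import HarnessLib

/-!
# Route LiouvilleSarnak — crux `LiouvilleCutRank` (stmt-ValiantsHypothesis-14775):
# a QUANTITATIVE rank lower bound for an ARBITRARY cut from certified cut points (no periodicity)

The saturation method of `…InterleavedUnbounded` / `…PeriodicRatio` needs an infinite self-similar family.  This
file gives its FINITE, quantitative counterpart, valid for ONE arbitrary cut `π` at ONE level `n` (cut word
`w ∈ {R,C}^{2n}` arbitrary — periodic or not):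

* ★ `card_le_two_pow_rank_of_certified` — let `P` be a set of cut points `p ≤ 2n` such that for all `p < p'` in
  `P` there is a CERTIFICATE `(c, x)`: `λ(c) = -1`, `x ≥ 1`, `x (c - 1) = m` where `m = Σ 2^{j-p}` over the ROW
  positions `j ∈ [p, p')`, and every bit `b` of `x - 1` sits at a COLUMN position `p + b`.  Then
  `#P ≤ 2^{rank M_π}`.  Proof: the prefix rows `r_p = 𝟙[row position < p]` (`p ∈ P`) of `M_π` are pairwise
  distinct — at the column `𝟙[column position < p] ∨ [bit (j-p) of x-1]` the two entries are `λ(2^p x)` and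
  `λ(2^p (x + m)) = λ(c · 2^p x) = -λ(2^p x)` — and a `±1` matrix with `#P` distinct rows has `#P ≤ 2^{rank}`
  (`LiouvilleSarnakAligned.card_image_row_le_two_pow_rank`).
* `le_rank_of_certified` — the `W ≤ rank` form.

This turns lower bounds for the crux into word combinatorics plus arithmetic of small numbers: e.g. for the
bit-interleaving cut `(CR)^n` the even cut points `p = 2s` are pairwise certified by `c = 3`
(`m = 2(4^{t-s}-1)/3`, `x = m/2`, bits of `x - 1` at even = column positions), giving `rank ≥ ⌊log₂ n⌋`
explicitly; in general a cut word yields `rank ≥ log₂ #P` for any family `P` of pairwise-certified cut points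
(`RR`-free stretches with `c = 3`, `R?R`-free stretches with `c = 5`, divisor certificates `(c - 1) ∣ m`, …).
Honest framing: a criterion; whether EVERY long balanced word has unboundedly many pairwise-certified cut points
is what remains of the crux here; `LiouvilleCutRank`, `DigitalBilinearLiouville`, `AlgebraicSarnak` stay OPEN;
nothing bears on `VP ≠ VNP`.  No definitions.
-/

set_option linter.dupNamespace false

noncomputable section

namespace Summit.ValiantsHypothesis.ValiantsHypothesis.Theorems.LiouvilleSarnakLiouvilleCutRank.CertifiedCutPoints

open ArithmeticFunction Finset

open Summit.ValiantsHypothesis.ValiantsHypothesis.Theorems.LiouvilleSarnakAligned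
  (card_image_row_le_two_pow_rank)
open Literature.Computability.AlgebraicComplexity.BoolGadgets (ofBits_eq_sum)

/-- The number with all bits below `p` set and the bits of `x - 1` above them: `ofBits` of
`j ↦ [j < p] ∨ bit_{j-p}(x-1)` on `2n ≥ p` positions is `2^p x - 1`, provided all bits of `x - 1` lie below
`2n - p`. [folklore] -/
theorem ofBits_prefix_or_shift (n p x : ℕ) (hp : p ≤ 2 * n) (hx : 1 ≤ x)
    (hbits : ∀ b : ℕ, (x - 1).testBit b = true → p + b < 2 * n) :
    Nat.ofBits (fun j : Fin (2 * n) => decide ((j : ℕ) < p) || (x - 1).testBit ((j : ℕ) - p)) =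
      2 ^ p * x - 1 := by
  apply Nat.eq_of_testBit_eq
  intro i
  have hval : 2 ^ p * x - 1 = 2 ^ p * (x - 1) + (2 ^ p - 1) := by
    have h1 : 1 ≤ 2 ^ p := Nat.one_le_two_pow
    obtain ⟨x', rfl⟩ := Nat.exists_eq_add_of_le' hx
    rw [Nat.add_sub_cancel, mul_add, mul_one]
    omega
  have h2p : 1 ≤ 2 ^ p := Nat.one_le_two_pow
  rw [hval, Nat.testBit_two_pow_mul_add _ (by omega : 2 ^ p - 1 < 2 ^ p), Nat.testBit_two_pow_sub_one]
  by_cases hi : i < 2 * n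
  · rw [Nat.testBit_ofBits_lt _ _ hi]
    by_cases hip : i < p
    · simp [hip]
    · simp [hip]
  · rw [Nat.testBit_ofBits_ge _ _ (by omega)]
    have hip : ¬ i < p := by omega
    rw [if_neg hip]
    cases h : (x - 1).testBit (i - p)
    · rfl
    · exact absurd (hbits _ h) (by omega)

/-- ★ **Certified cut points bound the rank from below.**  Let `π` be a cut of the `2n` bit positions and `P` a
set of cut points `p ≤ 2n` such that every pair `p < p'` in `P` has a certificate `(c, x)`: `λ(c) = -1`, `x ≥ 1`,
`x (c-1) = Σ_{row positions j ∈ [p,p')} 2^{j-p}`, and each bit `b` of `x - 1` is at a column position `p + b`.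
Then `#P ≤ 2^{rank M_π}` for the cut matrix `M_π(r,c) = λ(N_π(r,c) + 1)`. [this file] -/
theorem card_le_two_pow_rank_of_certified (n : ℕ) (π : Fin n ⊕ Fin n ≃ Fin (2 * n)) (P : Finset ℕ)
    (hP : ∀ p ∈ P, p ≤ 2 * n)
    (hcert : ∀ p ∈ P, ∀ p' ∈ P, p < p' → ∃ c x : ℕ, liouville c = -1 ∧ 1 ≤ x ∧
      x * (c - 1) = (∑ j : Fin (2 * n),
        if p ≤ (j : ℕ) ∧ (j : ℕ) < p' ∧ (π.symm j).isLeft = true then 2 ^ ((j : ℕ) - p) else 0) ∧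
      (∀ b : ℕ, (x - 1).testBit b = true → ∃ i : Fin n, (π (Sum.inr i) : ℕ) = p + b)) :
    P.card ≤ 2 ^ (Matrix.of fun r c : Fin n → Bool =>
      (((liouville (Nat.ofBits (fun k : Fin (2 * n) => Sum.elim r c (π.symm k)) + 1) : ℤ) : ℂ))).rank := by
  classical
  set M := (Matrix.of fun r c : Fin n → Bool =>
      (((liouville (Nat.ofBits (fun k : Fin (2 * n) => Sum.elim r c (π.symm k)) + 1) : ℤ) : ℂ))) with hM
  have hpm : ∀ r c, M r c = 1 ∨ M r c = -1 := by
    intro r c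
    rw [hM, Matrix.of_apply, liouville_apply (Nat.succ_ne_zero _)]
    rcases neg_one_pow_eq_or ℤ
        (cardFactors (Nat.ofBits (fun k : Fin (2 * n) => Sum.elim r c (π.symm k)) + 1)) with h | h
    · left; rw [h]; norm_num
    · right; rw [h]; norm_num
  -- the prefix rows `r_p(i) = [π(inl i) < p]`, and their pairwise distinctness
  have hne : ∀ p ∈ P, ∀ p' ∈ P, p < p' →
      M (fun i : Fin n => decide ((π (Sum.inl i) : ℕ) < p)) ≠ M (fun i : Fin n => decide ((π (Sum.inl i) : ℕ) < p')) := by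
    intro p hp p' hp' hpp' heq
    obtain ⟨c, x, hc, hx, hxm, hbits⟩ := hcert p hp p' hp' hpp'
    have hp2 : p ≤ 2 * n := hP p hp
    have hbits' : ∀ b : ℕ, (x - 1).testBit b = true → p + b < 2 * n := fun b hb => by
      obtain ⟨i, hi⟩ := hbits b hb
      have := (π (Sum.inr i)).2
      omega
    -- on row positions `j ≥ p` the shifted bits of `x - 1` vanish
    have htb : ∀ (j : Fin (2 * n)) (i : Fin n), π.symm j = Sum.inl i → p ≤ (j : ℕ) →
        (x - 1).testBit ((j : ℕ) - p) = false := by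
      intro j i hj hpj
      by_contra h
      rw [Bool.not_eq_false] at h
      obtain ⟨i', hi'⟩ := hbits _ h
      have h1 : π (Sum.inr i') = j := Fin.ext (by rw [hi']; omega)
      have h2 : π.symm j = Sum.inr i' := by rw [← h1, Equiv.symm_apply_apply]
      rw [hj] at h2
      exact Sum.inl_ne_inr h2
    -- the certificate column
    set col : Fin n → Bool := fun i => decide ((π (Sum.inr i) : ℕ) < p) ||
      (x - 1).testBit ((π (Sum.inr i) : ℕ) - p) with hcol
    -- bit function of (row p, col)
    have hbit1 : (fun j : Fin (2 * n) => Sum.elim (fun i : Fin n => decide ((π (Sum.inl i) : ℕ) < p)) col (π.symm j)) =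
        fun j : Fin (2 * n) => decide ((j : ℕ) < p) || (x - 1).testBit ((j : ℕ) - p) := by
      funext j
      rcases hj : π.symm j with i | i
      · have hji : (π (Sum.inl i) : ℕ) = j := by rw [← hj, Equiv.apply_symm_apply]
        simp only [Sum.elim_inl, hji]
        by_cases hjp : (j : ℕ) < p
        · simp [hjp]
        · rw [htb j i hj (by omega)]
          simp [hjp]
      · have hji : (π (Sum.inr i) : ℕ) = j := by rw [← hj, Equiv.apply_symm_apply]
        simp only [Sum.elim_inr, hcol, hji]
    -- bit function of (row p', col), bitwise: the previous one plus the row positions in `[p, p')`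
    have hbit2 : ∀ j : Fin (2 * n),
        (Sum.elim (fun i : Fin n => decide ((π (Sum.inl i) : ℕ) < p')) col (π.symm j)).toNat =
          (decide ((j : ℕ) < p) || (x - 1).testBit ((j : ℕ) - p)).toNat +
            (if p ≤ (j : ℕ) ∧ (j : ℕ) < p' ∧ (π.symm j).isLeft = true then 1 else 0) := by
      intro j
      rcases hj : π.symm j with i | i
      · have hji : (π (Sum.inl i) : ℕ) = j := by rw [← hj, Equiv.apply_symm_apply]
        simp only [Sum.elim_inl, hji, Sum.isLeft_inl, and_true]
        by_cases hjp : (j : ℕ) < p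
        · rw [if_neg (by omega)]
          simp [hjp, show (j : ℕ) < p' by omega]
        · rw [htb j i hj (by omega)]
          by_cases hjp' : (j : ℕ) < p'
          · rw [if_pos ⟨by omega, hjp'⟩]
            simp [hjp, hjp']
          · rw [if_neg (by omega)]
            simp [hjp, hjp']
      · have hji : (π (Sum.inr i) : ℕ) = j := by rw [← hj, Equiv.apply_symm_apply]
        simp only [Sum.elim_inr, hcol, hji, Sum.isLeft_inr]
        simp
    -- the two cut numbers
    have hN1 : Nat.ofBits (fun j : Fin (2 * n) =>
        Sum.elim (fun i : Fin n => decide ((π (Sum.inl i) : ℕ) < p)) col (π.symm j)) = 2 ^ p * x - 1 := by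
      rw [hbit1, ofBits_prefix_or_shift n p x hp2 hx hbits']
    have hS1 : (∑ t : Fin (2 * n), (decide ((t : ℕ) < p) || (x - 1).testBit ((t : ℕ) - p)).toNat * 2 ^ (t : ℕ)) =
        2 ^ p * x - 1 := by
      rw [← ofBits_prefix_or_shift n p x hp2 hx hbits', ofBits_eq_sum]
    have hS2 : (∑ t : Fin (2 * n),
        (if p ≤ (t : ℕ) ∧ (t : ℕ) < p' ∧ (π.symm t).isLeft = true then 1 else 0) * 2 ^ (t : ℕ)) =
        2 ^ p * (x * (c - 1)) := by
      rw [hxm, Finset.mul_sum]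
      refine Finset.sum_congr rfl fun t _ => ?_
      by_cases h : p ≤ (t : ℕ) ∧ (t : ℕ) < p' ∧ (π.symm t).isLeft = true
      · rw [if_pos h, if_pos h, one_mul, ← pow_add, Nat.add_sub_cancel' h.1]
      · rw [if_neg h, if_neg h, zero_mul, mul_zero]
    have hN2 : Nat.ofBits (fun j : Fin (2 * n) =>
        Sum.elim (fun i : Fin n => decide ((π (Sum.inl i) : ℕ) < p')) col (π.symm j)) =
        (2 ^ p * x - 1) + 2 ^ p * (x * (c - 1)) := by
      rw [ofBits_eq_sum, ← hS1, ← hS2, ← Finset.sum_add_distrib]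
      refine Finset.sum_congr rfl fun t _ => ?_
      rw [hbit2 t, add_mul]
    -- compare the two entries at `col`
    have h1 := congrFun heq col
    simp only [hM, Matrix.of_apply] at h1
    rw [hN1, hN2] at h1
    have hc1 : 1 ≤ c := by
      rcases Nat.eq_zero_or_pos c with h0 | h0
      · rw [h0] at hc; simp at hc
      · exact h0
    have hA : 1 ≤ 2 ^ p * x := le_trans hx (Nat.le_mul_of_pos_left x (Nat.two_pow_pos p))
    obtain ⟨c', rfl⟩ := Nat.exists_eq_add_of_le' hc1
    have e1 : 2 ^ p * x - 1 + 1 = 2 ^ p * x := by omega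
    have e2 : 2 ^ p * x - 1 + 2 ^ p * (x * (c' + 1 - 1)) + 1 = (c' + 1) * (2 ^ p * x) := by
      rw [Nat.add_sub_cancel]
      have : 2 ^ p * (x * c') = c' * (2 ^ p * x) := by ring
      rw [this]
      have h3 : 2 ^ p * x - 1 + c' * (2 ^ p * x) + 1 = 2 ^ p * x + c' * (2 ^ p * x) := by omega
      rw [h3]
      ring
    rw [e1, e2, Int.cast_inj, liouville_apply_mul (c' + 1) (2 ^ p * x), hc] at h1
    have hne0 : liouville (2 ^ p * x) ≠ 0 := liouville_ne_zero (by omega)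
    exact hne0 (by linarith)
  -- count: the prefix rows of the points of `P` are pairwise distinct rows of `M`
  have hinj : Set.InjOn (fun p : ℕ => M (fun i : Fin n => decide ((π (Sum.inl i) : ℕ) < p))) ↑P := by
    intro p hp p' hp' h
    by_contra hpp
    rcases lt_or_gt_of_ne hpp with hlt | hlt
    · exact hne p hp p' hp' hlt h
    · exact hne p' hp' p hp hlt h.symm
  calc P.card = (P.image fun p : ℕ => M (fun i : Fin n => decide ((π (Sum.inl i) : ℕ) < p))).card :=
        (Finset.card_image_of_injOn hinj).symm
    _ ≤ (Finset.univ.image fun r : Fin n → Bool => M r).card := by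
        refine Finset.card_le_card fun v hv => ?_
        obtain ⟨p, -, rfl⟩ := Finset.mem_image.mp hv
        exact Finset.mem_image.mpr ⟨_, Finset.mem_univ _, rfl⟩
    _ ≤ 2 ^ M.rank := card_image_row_le_two_pow_rank M hpm

/-- The `W ≤ rank` form: `2^W ≤ #P` pairwise-certified cut points give `rank M_π ≥ W`. [this file] -/
theorem le_rank_of_certified (n W : ℕ) (π : Fin n ⊕ Fin n ≃ Fin (2 * n)) (P : Finset ℕ) (hW : 2 ^ W ≤ P.card)
    (hP : ∀ p ∈ P, p ≤ 2 * n)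
    (hcert : ∀ p ∈ P, ∀ p' ∈ P, p < p' → ∃ c x : ℕ, liouville c = -1 ∧ 1 ≤ x ∧
      x * (c - 1) = (∑ j : Fin (2 * n),
        if p ≤ (j : ℕ) ∧ (j : ℕ) < p' ∧ (π.symm j).isLeft = true then 2 ^ ((j : ℕ) - p) else 0) ∧
      (∀ b : ℕ, (x - 1).testBit b = true → ∃ i : Fin n, (π (Sum.inr i) : ℕ) = p + b)) :
    W ≤ (Matrix.of fun r c : Fin n → Bool =>
      (((liouville (Nat.ofBits (fun k : Fin (2 * n) => Sum.elim r c (π.symm k)) + 1) : ℤ) : ℂ))).rank :=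
  (Nat.pow_le_pow_iff_right (by norm_num)).mp (hW.trans (card_le_two_pow_rank_of_certified n π P hP hcert))

end Summit.ValiantsHypothesis.ValiantsHypothesis.Theorems.LiouvilleSarnakLiouvilleCutRank.CertifiedCutPoints

end
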